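import Literature.MathematicalPhysics.StatisticalMechanics.Theil2006MinimumDistance
import HarnessLib

/-!
# Theil 2006, Theorem 1.1 from the main estimate (9): `lim_N min_y E(y)/N = −3`

Topic `Literature/MathematicalPhysics/StatisticalMechanics`; companion of `Theil2006.lean` (the
named fact `Theil2006_groundStateEnergy` = Theorem 1.1, the PROVED upper bound
`IsNormalized.eventually_minEnergy_div_le`) and `Theil2006MinimumDistance.lean` (Lemma 2.2, whose
mechanism — "(14): move a crowded cluster to infinity" — is re-run here for ARBITRARY
configurations). Everything here is PROVED (no `sorry`, no new named fact; D-0026).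

## Source, as printed (preprint p. 5, §2.1)

"Theorem 2.1 […] (9) `E(y) ≥ −3N − #𝒮(y) + […] + ¼ #∂X`. […] Theorem 1.1 is an immediate
consequence of Theorem 2.1: The upper bound `lim sup (1/N) min E ≤ −3` follows from […] the
trial configurations `y(x) = x`, `x ∈ A₂ ∩ B_R`. The lower bound `lim inf (1/N) min E ≥ −3` is
(9)." The minimum in Theorem 1.1 runs over ALL configurations, (9) is stated for configurations
with (13), and Lemma 2.2 gives (13) for ground states; the tree's `minEnergy V N = ⨅_y E(y)` is an
infimum (no existence of ground states is claimed), so the reduction below replaces "ground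
states satisfy (13)" by its constructive content: every configuration can be modified, without
raising the energy, into one satisfying (13).

## What is here

* `Theil2006.IsAdmissible.exists_far_competitor` — the competitor of (14) for an arbitrary
  configuration: the cluster `𝒜` expelled to infinity with diverging mutual distances,
  `E(y') ≤ E(y) − T(𝒜) + (N²+1)ε`, `y' = y` off `𝒜`, all bonds meeting `𝒜` of length `≥ R`.
* `Theil2006.IsAdmissible.exists_cluster_pos` — the heart of Lemma 2.2 for an arbitrary
  configuration with a pair at distance `≤ 1 − α` (`α < 1/13447168`): the particles `𝒜` of a most
  crowded disc of radius `(1−α)/2` contain such a pair and the bonds meeting `𝒜` have total energy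
  `T(𝒜) ≥ 1 > 0` (verbatim the estimate of `Theil2006_minimumDistance_holds`).
* `Theil2006.IsAdmissible.exists_separated_le` — **(13)-reduction**: for every `y : X_N → ℝ²`
  there is `y'` satisfying (13) with `E(y') ≤ E(y)` (induction on the number of close pairs).
* `Theil2006_groundStateEnergy_of_mainEstimate` — **Theorem 1.1 from (9)**: if for all small
  `α`, all admissible `V` and all configurations with (13) one has `E(y) ≥ −3N` (the consequence
  of (9) that Theorem 1.1 uses; `½Σ_𝒮(e_* + 1) + ¼#∂X ≥ 0`), then `Theil2006_groundStateEnergy`.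
  With `Theil2006ShortRangeResummation.exists_mainLocalEstimate_finite` this reduces Theorem 1.1
  to the Chapter-4 geometry (Lemma 2.7, Propositions 2.8, 2.9, (34)).
-/

noncomputable section

open scoped BigOperators Topology
open Filter Set Metric

namespace Literature.MathematicalPhysics.StatisticalMechanics

namespace Theil2006

variable {α : ℝ} {V : ℝ → ℝ} {N : ℕ}

/-! ### The competitor of (14) for an arbitrary configuration -/

/-- **The competitor of (14)**, for any configuration `y`, any cluster `𝒜`, any `ε > 0` and any
`R₁`: moving the particles of `𝒜` to `D(k+2) b₁` (`D` large) gives `y'` with `y' = y` off `𝒜`,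
all bonds meeting `𝒜` of length `≥ R₁`, and
`E(y') ≤ E(y) − Σ_{bonds meeting 𝒜} e + (N² + 1) ε` (`V < ε` far out, `V → 0`).
[cite: Theil2006, §2.2 proof of Lemma 2.2 (14) (preprint p. 6)] -/
theorem exists_far_competitor (hV0 : Tendsto V atTop (𝓝 0)) (y : Fin N → Plane)
    (A : Finset (Fin N)) {ε : ℝ} (hε : 0 < ε) (R₁ : ℝ) :
    ∃ y' : Fin N → Plane, (∀ k, k ∉ A → y' k = y k) ∧
      (∀ i j : Fin N, i < j → (i ∈ A ∨ j ∈ A) → R₁ ≤ dist (y' i) (y' j)) ∧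
      interactionEnergy V y' ≤ interactionEnergy V y -
        ∑ i, ∑ j ∈ Finset.Ioi i, (if i ∈ A ∨ j ∈ A then V (dist (y i) (y j)) else 0) +
        ((N : ℝ) ^ 2 + 1) * ε := by
  classical
  set T := ∑ i, ∑ j ∈ Finset.Ioi i, (if i ∈ A ∨ j ∈ A then V (dist (y i) (y j)) else 0) with hT
  -- `V < ε` on `[R, ∞)`, `R ≥ R₁`, `R ≥ 0`
  obtain ⟨R₀, hR₀⟩ := Filter.eventually_atTop.1 (hV0.eventually (gt_mem_nhds hε))
  set R := max (max R₀ 0) R₁ with hR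
  have hRV : ∀ s, R ≤ s → V s < ε := fun s hs =>
    hR₀ s (((le_max_left _ _).trans (le_max_left _ _)).trans hs)
  have hR0 : 0 ≤ R := (le_max_right _ _).trans (le_max_left _ _)
  have hR1 : R₁ ≤ R := le_max_right _ _
  -- a bound on the positions
  set B := ∑ k, ‖y k‖ with hB
  have hBk : ∀ k, ‖y k‖ ≤ B := fun k =>
    Finset.single_le_sum (fun k _ => norm_nonneg (y k)) (Finset.mem_univ k)
  have hB0 : 0 ≤ B := Finset.sum_nonneg fun k _ => norm_nonneg _
  set D := B + R + 1 with hD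
  have hD0 : 0 < D := by linarith
  clear_value D B
  -- the unit vector `b₁`
  have he : ‖triVec₁‖ = 1 := by
    have h2 : ‖triPoint (1, 0)‖ ^ 2 = 1 := by rw [norm_triPoint_sq]; norm_num
    have h1 : triPoint (1, 0) = triVec₁ := by simp [triPoint]
    rw [h1] at h2
    exact (pow_eq_one_iff_of_nonneg (norm_nonneg _) two_ne_zero).1 h2
  -- the competitor
  set y' : Fin N → Plane := fun k => if k ∈ A then (D * ((k : ℕ) + 2 : ℝ)) • triVec₁ else y k
    with hy'
  have hy'A : ∀ k, k ∈ A → y' k = (D * ((k : ℕ) + 2 : ℝ)) • triVec₁ := fun k hk => if_pos hk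
  have hy'nA : ∀ k, k ∉ A → y' k = y k := fun k hk => if_neg hk
  have hnorm' : ∀ k, k ∈ A → ‖y' k‖ = D * ((k : ℕ) + 2) := by
    intro k hk
    have hpos : (0 : ℝ) ≤ D * ((k : ℕ) + 2) := by positivity
    rw [hy'A k hk, norm_smul, he, mul_one, Real.norm_of_nonneg hpos]
  have hfar : ∀ i j : Fin N, i < j → (i ∈ A ∨ j ∈ A) → R ≤ dist (y' i) (y' j) := by
    intro i j hij hA
    by_cases hi : i ∈ A <;> by_cases hj : j ∈ A
    · have hsub : y' i - y' j = (D * ((i : ℕ) + 2 : ℝ) - D * ((j : ℕ) + 2 : ℝ)) • triVec₁ := by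
        rw [hy'A i hi, hy'A j hj, sub_smul]
      rw [dist_eq_norm, hsub, norm_smul, he, mul_one, Real.norm_eq_abs]
      have hlt : ((i : ℕ) : ℝ) + 1 ≤ ((j : ℕ) : ℝ) := by
        exact_mod_cast Nat.succ_le_of_lt (Fin.lt_def.1 hij)
      rw [abs_of_neg (by nlinarith)]
      nlinarith
    · have h1 : ‖y' i‖ - ‖y' j‖ ≤ dist (y' i) (y' j) := by
        rw [dist_eq_norm]; exact norm_sub_norm_le _ _
      have h2 : ‖y' j‖ ≤ B := by rw [hy'nA j hj]; exact hBk j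
      have h3 := hnorm' i hi
      have h4 : (0 : ℝ) ≤ (i : ℕ) := Nat.cast_nonneg _
      nlinarith
    · have h1 : ‖y' j‖ - ‖y' i‖ ≤ dist (y' i) (y' j) := by
        rw [dist_comm, dist_eq_norm]; exact norm_sub_norm_le _ _
      have h2 : ‖y' i‖ ≤ B := by rw [hy'nA i hi]; exact hBk i
      have h3 := hnorm' j hj
      have h4 : (0 : ℝ) ≤ (j : ℕ) := Nat.cast_nonneg _
      nlinarith
    · exact absurd hA (not_or.2 ⟨hi, hj⟩)
  refine ⟨y', hy'nA, fun i j hij hA => hR1.trans (hfar i j hij hA), ?_⟩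
  -- termwise comparison of the two energies
  have hterm : ∀ i j : Fin N, j ∈ Finset.Ioi i →
      V (dist (y' i) (y' j)) - V (dist (y i) (y j)) ≤
        (if i ∈ A ∨ j ∈ A then ε else 0) - (if i ∈ A ∨ j ∈ A then V (dist (y i) (y j)) else 0) := by
    intro i j hj
    rw [Finset.mem_Ioi] at hj
    by_cases hA : i ∈ A ∨ j ∈ A
    · rw [if_pos hA, if_pos hA]
      have := hRV _ (hfar i j hj hA)
      linarith
    · rw [if_neg hA, if_neg hA]
      obtain ⟨hi, hj'⟩ := not_or.1 hA
      rw [hy'nA i hi, hy'nA j hj', sub_self, sub_self]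
  have hsum : interactionEnergy V y' - interactionEnergy V y ≤
      ∑ i, ∑ j ∈ Finset.Ioi i, (if i ∈ A ∨ j ∈ A then ε else (0 : ℝ)) - T := by
    rw [interactionEnergy, interactionEnergy, ← Finset.sum_sub_distrib, hT,
      ← Finset.sum_sub_distrib]
    refine Finset.sum_le_sum fun i _ => ?_
    rw [← Finset.sum_sub_distrib, ← Finset.sum_sub_distrib]
    exact Finset.sum_le_sum fun j hj => hterm i j hj
  have hcount : ∑ i, ∑ j ∈ Finset.Ioi i, (if i ∈ A ∨ j ∈ A then ε else (0 : ℝ)) ≤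
      ((N : ℝ) ^ 2 + 1) * ε := by
    have hin : ∀ i : Fin N,
        ∑ j ∈ Finset.Ioi i, (if i ∈ A ∨ j ∈ A then ε else (0 : ℝ)) ≤ N * ε := by
      intro i
      calc ∑ j ∈ Finset.Ioi i, (if i ∈ A ∨ j ∈ A then ε else (0 : ℝ))
          ≤ ∑ j ∈ Finset.Ioi i, ε := Finset.sum_le_sum fun j _ => by split_ifs <;> linarith
        _ ≤ ∑ _j : Fin N, ε :=
          Finset.sum_le_sum_of_subset_of_nonneg (Finset.subset_univ _) fun _ _ _ => hε.le
        _ = N * ε := by simp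
    calc ∑ i, ∑ j ∈ Finset.Ioi i, (if i ∈ A ∨ j ∈ A then ε else (0 : ℝ))
        ≤ ∑ _i : Fin N, (N : ℝ) * ε := Finset.sum_le_sum fun i _ => hin i
      _ = (N : ℝ) ^ 2 * ε := by simp; ring
      _ ≤ ((N : ℝ) ^ 2 + 1) * ε := by nlinarith
  linarith

/-! ### The heart of Lemma 2.2 for an arbitrary configuration -/

/-- **Lemma 2.2, constructive content.** For `V` satisfying (1)–(5) with `0 < α < 1/13447168`
and a configuration `y` with two particles at distance `≤ 1 − α`, the particles `𝒜` of a most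
crowded closed disc of radius `(1−α)/2` contain two distinct labels, lie pairwise within `1 − α`,
and the bonds meeting `𝒜` have total energy `≥ 1`: the `M(M−1)/2` bonds inside cost `≥ 1/α`
each by (2), the bonds leaving `𝒜` cost `≥ −K₀ w(cell)` with summable cell weights, at most `M`
particles per cell ((11), (12)). [cite: Theil2006, §2.2 proof of Lemma 2.2 (preprint p. 6)] -/
theorem IsAdmissible.exists_cluster_pos (hV : IsAdmissible α V) (hα : 0 < α)
    (hαlt : α < 1 / 13447168) {y : Fin N → Plane} {i j : Fin N} (hij : i ≠ j)
    (hcon : dist (y i) (y j) ≤ 1 - α) :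
    ∃ A : Finset (Fin N), (∃ a ∈ A, ∃ b ∈ A, a ≠ b) ∧
      (∀ a ∈ A, ∀ b ∈ A, dist (y a) (y b) ≤ 1 - α) ∧
      1 ≤ ∑ i, ∑ j ∈ Finset.Ioi i, (if i ∈ A ∨ j ∈ A then V (dist (y i) (y j)) else 0) := by
  classical
  have hα5 : α ≤ 1 / 5 := by linarith
  set ρ := (1 - α) / 2 with hρdef
  have hρ25 : 2 / 5 ≤ ρ := by rw [hρdef]; linarith
  have hρ12 : ρ ≤ 1 / 2 := by rw [hρdef]; linarith
  have hρ0 : 0 < ρ := by linarith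
  -- local particle counts in closed discs of radius `ρ`, and their maximum `M`
  set cnt : Plane → ℕ := fun η => (Finset.univ.filter fun k : Fin N => dist (y k) η ≤ ρ).card
    with hcnt
  have hbdd : BddAbove (Set.range cnt) := by
    refine ⟨N, ?_⟩
    rintro _ ⟨η, rfl⟩
    exact (Finset.card_filter_le _ _).trans (by simp)
  set M := sSup (Set.range cnt) with hMdef
  have hle : ∀ η, cnt η ≤ M := fun η => le_csSup hbdd ⟨η, rfl⟩
  obtain ⟨η₀, hη₀⟩ : ∃ η₀, cnt η₀ = M := Nat.sSup_mem (s := Set.range cnt) ⟨cnt 0, 0, rfl⟩ hbdd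
  -- two particles at distance `≤ 1 - α`: the disc about their midpoint holds both, so `M ≥ 2`
  have hM2 : 2 ≤ M := by
    set m : Plane := (2 : ℝ)⁻¹ • (y i + y j) with hm
    have hdi : dist (y i) m ≤ ρ := by
      have e : y i - m = (2 : ℝ)⁻¹ • (y i - y j) := by rw [hm]; module
      rw [dist_eq_norm, e, norm_smul, Real.norm_eq_abs, abs_of_pos (by norm_num), ← dist_eq_norm]
      rw [hρdef]; linarith
    have hdj : dist (y j) m ≤ ρ := by
      have e : y j - m = (2 : ℝ)⁻¹ • (y j - y i) := by rw [hm]; module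
      rw [dist_eq_norm, e, norm_smul, Real.norm_eq_abs, abs_of_pos (by norm_num), ← dist_eq_norm,
        dist_comm]
      rw [hρdef]; linarith
    have hsub : ({i, j} : Finset (Fin N)) ⊆
        Finset.univ.filter fun k : Fin N => dist (y k) m ≤ ρ := by
      intro k hk
      rw [Finset.mem_insert, Finset.mem_singleton] at hk
      rw [Finset.mem_filter]
      rcases hk with rfl | rfl
      · exact ⟨Finset.mem_univ _, hdi⟩
      · exact ⟨Finset.mem_univ _, hdj⟩
    have := Finset.card_le_card hsub
    rw [Finset.card_pair hij] at this
    exact this.trans (hle m)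
  -- the cluster `𝒜 = y⁻¹ B(η₀, ρ)`, `#𝒜 = M`
  set A := Finset.univ.filter fun k : Fin N => dist (y k) η₀ ≤ ρ with hA
  have hAcard : A.card = M := hη₀
  have hAmem : ∀ k, k ∈ A ↔ dist (y k) η₀ ≤ ρ := fun k => by simp [hA]
  have hAdist : ∀ a ∈ A, ∀ b ∈ A, dist (y a) (y b) ≤ 1 - α := by
    intro a ha b hb
    have := dist_triangle (y a) η₀ (y b)
    rw [dist_comm η₀] at this
    linarith [(hAmem a).1 ha, (hAmem b).1 hb]
  have hApair : ∃ a ∈ A, ∃ b ∈ A, a ≠ b := by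
    have h1 : 1 < A.card := by rw [hAcard]; omega
    obtain ⟨a, ha, b, hb, hab⟩ := Finset.one_lt_card.1 h1
    exact ⟨a, ha, b, hb, hab⟩
  refine ⟨A, hApair, hAdist, ?_⟩
  -- the cell weights of the particles
  set wt : ℤ → ℝ := fun n => ((((n.natAbs : ℕ) : ℝ) + 1) * (((n.natAbs : ℕ) : ℝ) + 2))⁻¹ with hwt
  set w : Fin N → ℝ := fun k =>
    420224 * (wt ⌊(y k 0 - η₀ 0) / ρ⌋ * wt ⌊(y k 1 - η₀ 1) / ρ⌋) with hw
  have hw0 : ∀ k, 0 ≤ w k := fun k => by positivity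
  -- total weight `≤ W M`, `W = 4 K₀`
  have hwsum : ∑ k, w k ≤ 4 * 420224 * M := by
    have h := sum_cellWeight_le y η₀ hρ0 (M := M) (fun z => hle z)
      (f := fun c : ℤ × ℤ => wt c.1 * wt c.2) (fun c => by positivity) (F := 4)
      (fun t => by simpa [hwt] using sum_prod_inv_natAbs_le_four t)
    have e : ∑ k, w k = 420224 * ∑ k, wt ⌊(y k 0 - η₀ 0) / ρ⌋ * wt ⌊(y k 1 - η₀ 1) / ρ⌋ := by
      rw [Finset.mul_sum]
    rw [e]
    nlinarith
  -- termwise lower bound on the bonds meeting `𝒜`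
  have hpair : ∀ i j : Fin N,
      (if i ∈ A ∧ j ∈ A then (1 : ℝ) else 0) * (1 / α) -
        ((if i ∈ A ∧ j ∉ A then w j else 0) + (if i ∉ A ∧ j ∈ A then w i else 0)) ≤
      (if i ∈ A ∨ j ∈ A then V (dist (y i) (y j)) else 0) := by
    intro i j
    by_cases hi : i ∈ A <;> by_cases hj : j ∈ A
    · have hd : dist (y i) (y j) ≤ 1 - α := hAdist i hi j hj
      have := hV.core (dist (y i) (y j)) ⟨dist_nonneg, hd⟩
      simp only [hi, hj, and_self, if_true, true_or, not_true, and_false, false_and, if_false,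
        add_zero, one_mul]
      linarith
    · have := hV.neg_cellWeight_le hα hα5 hρ25 η₀ (y i) (y j) ((hAmem i).1 hi)
      simp only [hi, hj, and_true, and_false, if_false, if_true, true_or, not_true, not_false_iff,
        zero_mul, add_zero, zero_sub, hw, hwt]
      linarith
    · have := hV.neg_cellWeight_le hα hα5 hρ25 η₀ (y j) (y i) ((hAmem j).1 hj)
      rw [dist_comm] at this
      simp only [hi, hj, and_true, and_false, if_false, if_true, or_true, not_true, not_false_iff,
        zero_mul, zero_add, zero_sub, hw, hwt]
      linarith
    · simp [hi, hj]
  have hTlow : (((M : ℝ) ^ 2 - M) / 2) * (1 / α) - M * ∑ k, w k ≤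
      ∑ i, ∑ j ∈ Finset.Ioi i, (if i ∈ A ∨ j ∈ A then V (dist (y i) (y j)) else 0) := by
    have h1 := sum_Ioi_ite_mem_and_mem A
    have h2 := sum_Ioi_cross_le A hw0
    rw [hAcard] at h1 h2
    calc (((M : ℝ) ^ 2 - M) / 2) * (1 / α) - M * ∑ k, w k
        ≤ (∑ i, ∑ j ∈ Finset.Ioi i, (if i ∈ A ∧ j ∈ A then (1 : ℝ) else 0)) * (1 / α) -
          ∑ i, ∑ j ∈ Finset.Ioi i,
            ((if i ∈ A ∧ j ∉ A then w j else 0) + (if i ∉ A ∧ j ∈ A then w i else 0)) := by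
          rw [h1]; linarith
      _ = ∑ i, ∑ j ∈ Finset.Ioi i, ((if i ∈ A ∧ j ∈ A then (1 : ℝ) else 0) * (1 / α) -
          ((if i ∈ A ∧ j ∉ A then w j else 0) + (if i ∉ A ∧ j ∈ A then w i else 0))) := by
          rw [Finset.sum_mul, ← Finset.sum_sub_distrib]
          refine Finset.sum_congr rfl fun i _ => ?_
          rw [Finset.sum_mul, ← Finset.sum_sub_distrib]
      _ ≤ _ := Finset.sum_le_sum fun i _ => Finset.sum_le_sum fun j _ => hpair i j
  -- the final count: `T ≥ M(M-1)/(2α) − M²W ≥ 1`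
  have hM2r : (2 : ℝ) ≤ M := by exact_mod_cast hM2
  have hMw : (M : ℝ) * ∑ k, w k ≤ (M : ℝ) * (4 * 420224 * M) :=
    mul_le_mul_of_nonneg_left hwsum (by linarith)
  have hinv : (13447168 : ℝ) ≤ 1 / α := by
    rw [le_div_iff₀ hα]; nlinarith
  have hq : (M : ℝ) ^ 2 / 4 ≤ ((M : ℝ) ^ 2 - M) / 2 := by nlinarith
  have hprod : (M : ℝ) ^ 2 / 4 * 13447168 ≤ (((M : ℝ) ^ 2 - M) / 2) * (1 / α) :=
    mul_le_mul hq hinv (by norm_num) (by nlinarith)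
  nlinarith

/-! ### The (13)-reduction -/

/-- **(13)-reduction.** For `V` satisfying (1)–(5) with `0 < α < 1/13447168`, every configuration
`y : X_N → ℝ²` can be replaced by one satisfying (13) `min_{x≠x'}|y'(x) − y'(x')| > 1 − α` whose
energy is not larger (repeat: expel the most crowded cluster to infinity — the energy drops by
`≥ ½` and the number of pairs at distance `≤ 1 − α` decreases).
[cite: Theil2006, §2.2 Lemma 2.2 and its proof (preprint p. 6)] -/
theorem IsAdmissible.exists_separated_le (hV : IsAdmissible α V) (hα : 0 < α)
    (hαlt : α < 1 / 13447168) (y : Fin N → Plane) :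
    ∃ y' : Fin N → Plane, (∀ i j : Fin N, i ≠ j → 1 - α < dist (y' i) (y' j)) ∧
      interactionEnergy V y' ≤ interactionEnergy V y := by
  classical
  -- induction on the number of ordered close pairs
  suffices h : ∀ (n : ℕ) (y : Fin N → Plane),
      (Finset.univ.filter fun p : Fin N × Fin N =>
          p.1 < p.2 ∧ dist (y p.1) (y p.2) ≤ 1 - α).card ≤ n →
        ∃ y' : Fin N → Plane, (∀ i j : Fin N, i ≠ j → 1 - α < dist (y' i) (y' j)) ∧
          interactionEnergy V y' ≤ interactionEnergy V y from h _ y le_rfl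
  intro n
  induction n with
  | zero =>
    intro y hy
    refine ⟨y, fun i j hij => ?_, le_rfl⟩
    by_contra hcon
    rw [not_lt] at hcon
    have hemp := Finset.card_eq_zero.1 (Nat.le_zero.1 hy)
    rcases lt_or_gt_of_ne hij with h | h
    · have : (i, j) ∈ Finset.univ.filter fun p : Fin N × Fin N =>
          p.1 < p.2 ∧ dist (y p.1) (y p.2) ≤ 1 - α := Finset.mem_filter.2 ⟨Finset.mem_univ _, h, hcon⟩
      rw [hemp] at this; simp at this
    · have : (j, i) ∈ Finset.univ.filter fun p : Fin N × Fin N =>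
          p.1 < p.2 ∧ dist (y p.1) (y p.2) ≤ 1 - α :=
        Finset.mem_filter.2 ⟨Finset.mem_univ _, h, by rwa [dist_comm]⟩
      rw [hemp] at this; simp at this
  | succ n ih =>
    intro y hy
    by_cases hsep : ∀ i j : Fin N, i ≠ j → 1 - α < dist (y i) (y j)
    · exact ⟨y, hsep, le_rfl⟩
    push Not at hsep
    obtain ⟨i, j, hij, hcon⟩ := hsep
    obtain ⟨A, ⟨a, ha, b, hb, hab⟩, hAdist, hT⟩ := hV.exists_cluster_pos hα hαlt hij hcon
    have hN : (0 : ℝ) < (N : ℝ) ^ 2 + 1 := by positivity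
    obtain ⟨y', hy'nA, hfar, hE⟩ := exists_far_competitor hV.tendsto_zero y A
      (ε := 1 / (2 * ((N : ℝ) ^ 2 + 1))) (by positivity) 2
    have hE' : interactionEnergy V y' ≤ interactionEnergy V y := by
      have e : ((N : ℝ) ^ 2 + 1) * (1 / (2 * ((N : ℝ) ^ 2 + 1))) = 1 / 2 := by
        field_simp
      rw [e] at hE
      linarith
    -- the close pairs of `y'` are close pairs of `y` not meeting `𝒜`
    have hsub : (Finset.univ.filter fun p : Fin N × Fin N =>
        p.1 < p.2 ∧ dist (y' p.1) (y' p.2) ≤ 1 - α) ⊆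
        Finset.univ.filter fun p : Fin N × Fin N => p.1 < p.2 ∧ dist (y p.1) (y p.2) ≤ 1 - α := by
      intro p hp
      rw [Finset.mem_filter] at hp ⊢
      obtain ⟨-, hlt, hd⟩ := hp
      by_cases hpA : p.1 ∈ A ∨ p.2 ∈ A
      · have := hfar p.1 p.2 hlt hpA
        linarith
      · obtain ⟨h1, h2⟩ := not_or.1 hpA
        rw [hy'nA p.1 h1, hy'nA p.2 h2] at hd
        exact ⟨Finset.mem_univ _, hlt, hd⟩
    -- and the pair `{a, b} ⊂ 𝒜` is no longer close
    have hlost : ∃ p ∈ (Finset.univ.filter fun p : Fin N × Fin N =>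
        p.1 < p.2 ∧ dist (y p.1) (y p.2) ≤ 1 - α),
        p ∉ Finset.univ.filter fun p : Fin N × Fin N =>
          p.1 < p.2 ∧ dist (y' p.1) (y' p.2) ≤ 1 - α := by
      have key : ∀ a b : Fin N, a ∈ A → b ∈ A → a < b →
          (a, b) ∈ (Finset.univ.filter fun p : Fin N × Fin N =>
            p.1 < p.2 ∧ dist (y p.1) (y p.2) ≤ 1 - α) ∧
          (a, b) ∉ Finset.univ.filter fun p : Fin N × Fin N =>
            p.1 < p.2 ∧ dist (y' p.1) (y' p.2) ≤ 1 - α := by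
        intro a b ha hb hlt
        refine ⟨Finset.mem_filter.2 ⟨Finset.mem_univ _, hlt, hAdist a ha b hb⟩, fun h => ?_⟩
        rw [Finset.mem_filter] at h
        have := hfar a b hlt (Or.inl ha)
        linarith [h.2.2]
      rcases lt_or_gt_of_ne hab with h | h
      · exact ⟨(a, b), (key a b ha hb h).1, (key a b ha hb h).2⟩
      · exact ⟨(b, a), (key b a hb ha h).1, (key b a hb ha h).2⟩
    have hcard := Finset.card_lt_card (Finset.ssubset_iff_of_subset hsub |>.2 hlost)
    obtain ⟨y'', hsep'', hE''⟩ := ih y' (by omega)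
    exact ⟨y'', hsep'', hE''.trans hE'⟩

end Theil2006

/-! ### Theorem 1.1 from the main estimate -/

open Theil2006 in
/-- **Theil 2006, Theorem 1.1 from (9).** If there is `α₁ > 0` such that for all `α ∈ (0, α₁)`,
all `V` satisfying (1)–(5) and all configurations `y : X_N → ℝ²` with (13) one has
`E(y) ≥ −3N` (the consequence of the main estimate (9) used on p. 5:
`½Σ_𝒮(e_* + 1) + ¼#∂X ≥ 0`), then Theorem 1.1 holds:
`lim_{N→∞} min_y E(y)/N = −3` for all small `α`. Lower bound: the (13)-reduction
(`IsAdmissible.exists_separated_le`) and the hypothesis give `E(y) ≥ −3N` for EVERY `y`; upper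
bound: the trial states of `IsNormalized.eventually_minEnergy_div_le` (tree).
[cite: Theil2006, §2.1 (Theorem 1.1 from Theorem 2.1, preprint p. 5)] -/
theorem Theil2006_groundStateEnergy_of_mainEstimate
    (h9 : ∃ α₁ : ℝ, 0 < α₁ ∧ ∀ α : ℝ, 0 < α → α < α₁ → ∀ V : ℝ → ℝ, IsAdmissible α V →
      ∀ (N : ℕ) (y : Fin N → Plane), (∀ i j : Fin N, i ≠ j → 1 - α < dist (y i) (y j)) →
        -3 * (N : ℝ) ≤ interactionEnergy V y) :
    Theil2006_groundStateEnergy := by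
  obtain ⟨α₁, hα₁, h9⟩ := h9
  refine ⟨min α₁ (1 / 13447168), lt_min hα₁ (by norm_num),
    (min_le_right _ _).trans_lt (by norm_num), fun α hα hαlt V hV => ?_⟩
  have hα' : α < α₁ := hαlt.trans_le (min_le_left _ _)
  have hα'' : α < 1 / 13447168 := hαlt.trans_le (min_le_right _ _)
  have hα5 : α ≤ 1 / 5 := by linarith
  -- lower bound for every configuration
  have hlow : ∀ (N : ℕ) (y : Fin N → Plane), -3 * (N : ℝ) ≤ interactionEnergy V y := by
    intro N y
    obtain ⟨y', hsep, hE⟩ := hV.exists_separated_le hα hα'' y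
    exact (h9 α hα hα' V hV N y' hsep).trans hE
  have hmin : ∀ N : ℕ, -3 * (N : ℝ) ≤ minEnergy V N := fun N => le_ciInf fun y => hlow N y
  -- upper bound (tree)
  have hup := fun ε (hε : 0 < ε) =>
    hV.toIsNormalized.eventually_minEnergy_div_le (c := -134)
      (fun r hr => hV.lowerBound hα hα5 hr) hε
  rw [tendsto_order]
  refine ⟨fun b hb => ?_, fun b hb => ?_⟩
  · filter_upwards [eventually_gt_atTop 0] with N hN
    have hN : (0 : ℝ) < N := by exact_mod_cast hN
    have : -3 ≤ minEnergy V N / N := by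
      rw [le_div_iff₀ hN]
      linarith [hmin N]
    linarith
  · filter_upwards [hup ((b + 3) / 2) (by linarith)] with N hN
    linarith

end Literature.MathematicalPhysics.StatisticalMechanics

end
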